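import Mathlib
import Summits.Ventures.PercRepro2.Defs
import Summits.Ventures.PercRepro2.Harris
import Summits.Ventures.PercRepro2.Graph
import Summits.Ventures.PercRepro2.Events
import Summits.Ventures.PercRepro2.SeedSet
import Summits.Ventures.PercRepro2.MultiSourceFun
import Summits.Ventures.PercRepro2.CCTRootEdge
import Summits.Ventures.PercRepro2.PASubDefs
import Summits.Ventures.PercRepro2.PASub

/-!
# Row 2′MM0 (MM0⁻): the cross-cluster BHK inequality under the gate with the edge `e` forced open,
and the exact shift-product form of the remaining gap (blind cell PercRepro2, night-1 g2;
`proofs/NIGHT1-MM0.md`)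

Vocabulary of `PASubDefs` (typer-1): an edge `e` (the free edge `{u, w}`), `ω⁺ = ω[e ↦ open]`,
`ω⁻ = ω[e ↦ closed]`, seed set `T` (`= {t}`), root `s`:

* `Kset = C_{ω⁺}(T)` — the `e`-open cluster of `T` (`K⁺`); `Rplus = {s ∉ K⁺}` — the GATE
  `{s ↮ T in H + e}`; `Xminus b = {s ↔ b in ω⁻}` — the marker `y = 1[b ∈ C_H(s)]` of the graph
  `H = ω⁻` WITHOUT `e`;
* new: `Vplus v = {v ∈ K⁺}` — `Z = 1[v ↔ T in H + e]`; `Rminus = {s ∉ C_{ω⁻}(T)}` — `R_T` of `H`;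
  `Vminus v = {v ∈ C_{ω⁻}(T)}` — `Z₀ = 1[v ∈ K]` of `H`.

**`gate_cross_bhk`** (THEOREM, the lead's «first lemma to type», INBOX 2026-08-23T23:12:20Z):
`P(Y⁻ ∩ V⁺ ∩ R⁺) · P(R⁺) ≤ P(Y⁻ ∩ R⁺) · P(V⁺ ∩ R⁺)`, i.e. `Cov(y, Z | gate) ≤ 0` — van den
Berg–Häggström–Kahn Thm 1.4 in `H + e` with `e` deterministic, for the `e`-CLOSED marker `y` (not a
vertex-set function of the `e`-open cluster of `s`). Proof = the T-frame of `paSub`: partition by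
`K⁺ = W`; on `{K⁺ = W}` with `s ∉ W` the event `Y⁻` is `X_W` (the `e`-closed connection with the
edges at `W` deleted), independent of `{K⁺ = W}`; `V⁺` is the constant `[v ∈ W]`; then `bhk_multi`
for the seed set `T` avoiding `{s}` under `p[e ↦ 1]` with the monotone functionals `1 − x̄(W)` and
`[v ∈ W]`, transferred by `expect_update_one_K`.

**`mm0minus_identity`**: with `a = P(R⁻)`, `g = P(R⁺)` and the masses `Y_R, Z_R` (of `H`),
`Y_E, Z_E, YZ_E` (on the gate), the cleared (MM0⁻) form
`F = a²·YZ_E − a·Y_R·Z_E − a·Z_R·Y_E + Y_R·Z_R·g` (`= P(R⁻)² · E[(y − ȳ)(Z − c); gate]`) satisfies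
`g · F = a²·(g·YZ_E − Y_E·Z_E) + (a·Y_E − g·Y_R)·(a·Z_E − g·Z_R)`:
the first term is `−a²·(BHK slack) ≤ 0` by `gate_cross_bhk`, the second is the SHIFT PRODUCT
`a²g²·(E[y | gate] − E[y | R_T])·(P(Z | gate) − P(Z₀ | R_T))`.

**`mm0minus_of_shift_le_slack`**: (MM0⁻) holds iff the shift product is at most `a²` times the BHK
slack; **`mm0minus_of_agreeing_shifts`**: in particular (MM0⁻) holds whenever the two shifts have
opposite signs or vanish. The open content of row 2′MM0 is therefore EXACTLY the disagreeing-sign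
regime `(E[y|gate] − ȳ)(P(Z|gate) − c) > 0`, where the BHK slack must pay for the product (exact
census: n = 6 FULL and n = 7 m ≤ 13 all tuples 0 negatives, (1+1)-ES adversary 0 exact negatives
in 2,406 runs; `proofs/NIGHT1-MM0.md`).
-/

namespace Summit.Ventures.PercRepro2
namespace MM0GateBHK

open PASub

open scoped Classical

variable {V : Type*} {E : Type*} [Fintype E] [DecidableEq E] [Fintype V] [DecidableEq V]
  {R : Type*} [Field R] [LinearOrder R] [IsStrictOrderedRing R]

variable (ends : E → Sym2 V) (e : E) (s : V) (T : Finset V)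

/-! ## The new events -/

/-- `V⁺ = {v ∈ K⁺}`: `v` lies in the `e`-open cluster of the seed set (`v ↔ T in H + e`). -/
def Vplus (v : V) : Set (Config E) := {ω | v ∈ Kset ends e T ω}

/-- `R⁻ = {s ∉ C_{ω⁻}(T)}`: the avoidance `R_T` of the graph `H = ω⁻` (the edge `e` closed). -/
def Rminus : Set (Config E) := {ω | Function.update ω e false ∈ avoidAll ends s T}

/-- `V⁻ = {v ∈ C_{ω⁻}(T)}`: `v` lies in the `e`-closed cluster of the seed set (`v ∈ K` in `H`). -/
def Vminus (v : V) : Set (Config E) := {ω | v ∈ clusterSet ends (Function.update ω e false) T}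

omit [Fintype E] [DecidableEq V] [Fintype V] in
/-- On `{K⁺ = W}`, `V⁺` is the constant `[v ∈ W]`. -/
lemma Vplus_inter_KEvent (v : V) (W : Set V) :
    Vplus ends e T v ∩ KEvent ends e T W = if v ∈ W then KEvent ends e T W else ∅ := by
  ext ω
  simp only [Vplus, KEvent, Set.mem_inter_iff, Set.mem_setOf_eq]
  split_ifs with hv
  · constructor
    · rintro ⟨_, hK⟩; exact hK
    · intro hK; exact ⟨by rw [hK]; exact hv, hK⟩
  · simp only [Set.mem_empty_iff_false, iff_false, not_and]
    intro hvK hK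
    exact hv (hK ▸ hvK)

/-! ## The theorem -/

section Main

variable (p : E → R)

/-- **Cross-cluster BHK under the gate with `e` forced open**:
`P(Y⁻ ∩ V⁺ ∩ R⁺) · P(R⁺) ≤ P(Y⁻ ∩ R⁺) · P(V⁺ ∩ R⁺)`, i.e. `Cov(1[b ∈ C_H(s)], 1[v ∈ K⁺] | gate) ≤ 0`. -/
theorem gate_cross_bhk (hp : IsProbVec p) (b v : V) :
    prob p (Xminus ends e s b ∩ Vplus ends e T v ∩ Rplus ends e s T) * prob p (Rplus ends e s T) ≤
      prob p (Xminus ends e s b ∩ Rplus ends e s T) * prob p (Vplus ends e T v ∩ Rplus ends e s T) := by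
  have hp₁ : IsProbVec (Function.update p e 1) := hp.update e zero_le_one le_rfl
  -- the partition identities (T-frame)
  have hpart : ∀ (A : Set (Config E)) (g : Set V → R),
      (∀ W, s ∉ W → prob p (A ∩ KEvent ends e T W) = g W * prob p (KEvent ends e T W)) →
      prob p (A ∩ Rplus ends e s T) =
        ∑ W : Set V, if s ∉ W then g W * prob p (KEvent ends e T W) else 0 := by
    intro A g hg
    rw [prob_inter_Rplus_eq_sum]
    refine Finset.sum_congr rfl fun W _ => ?_
    by_cases hs : s ∉ W
    · rw [if_pos hs, if_pos hs, hg W hs]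
    · rw [if_neg hs, if_neg hs]
  have hY : prob p (Xminus ends e s b ∩ Rplus ends e s T) =
      ∑ W : Set V, if s ∉ W then prob p (Xdel ends e s W b) * prob p (KEvent ends e T W) else 0 := by
    refine hpart _ _ fun W hs => ?_
    rw [← prob_Xdel_inter_KEvent]
    congr 1
    ext ω
    simp only [Set.mem_inter_iff]
    constructor
    · rintro ⟨hx, hK⟩; exact ⟨(mem_X_iff_of_K ends e s T hK hs b).1 hx, hK⟩
    · rintro ⟨hx, hK⟩; exact ⟨(mem_X_iff_of_K ends e s T hK hs b).2 hx, hK⟩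
  have hYV : prob p (Xminus ends e s b ∩ Vplus ends e T v ∩ Rplus ends e s T) =
      ∑ W : Set V, if s ∉ W then
        (if v ∈ W then prob p (Xdel ends e s W b) else 0) * prob p (KEvent ends e T W) else 0 := by
    refine hpart _ _ fun W hs => ?_
    rw [Set.inter_assoc, Vplus_inter_KEvent]
    split_ifs with hv
    · rw [← prob_Xdel_inter_KEvent]
      congr 1
      ext ω
      simp only [Set.mem_inter_iff]
      constructor
      · rintro ⟨hx, hK⟩; exact ⟨(mem_X_iff_of_K ends e s T hK hs b).1 hx, hK⟩
      · rintro ⟨hx, hK⟩; exact ⟨(mem_X_iff_of_K ends e s T hK hs b).2 hx, hK⟩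
    · rw [Set.inter_empty, prob_empty, zero_mul]
  have hV : prob p (Vplus ends e T v ∩ Rplus ends e s T) =
      ∑ W : Set V, if s ∉ W then (if v ∈ W then (1 : R) else 0) * prob p (KEvent ends e T W)
        else 0 := by
    refine hpart _ _ fun W _ => ?_
    rw [Vplus_inter_KEvent]
    split_ifs
    · rw [one_mul]
    · rw [prob_empty, zero_mul]
  have hR : prob p (Rplus ends e s T) =
      ∑ W : Set V, if s ∉ W then prob p (KEvent ends e T W) else 0 := by
    have := hpart Set.univ (fun _ => 1) (fun W _ => by rw [Set.univ_inter, one_mul])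
    rw [Set.univ_inter] at this
    simpa only [one_mul] using this
  -- the seed-set BHK under the `e`-open measure with `1 − x̄` and `[v ∈ ·]`
  have hx_anti : ∀ {W W' : Set V}, W ⊆ W' →
      prob p (Xdel ends e s W' b) ≤ prob p (Xdel ends e s W b) :=
    fun h => prob_mono hp (Xdel_anti ends e s h b)
  have hF₂ : Monotone (fun W : Set V => if v ∈ W then (1 : R) else 0) := by
    intro W W' h
    simp only
    by_cases hv : v ∈ W
    · rw [if_pos hv, if_pos (h hv)]
    · rw [if_neg hv]
      split_ifs
      · exact zero_le_one
      · exact le_refl _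
  have key := bhk_multi (Function.update p e 1) hp₁ ends T
    (F₁ := fun W => 1 - prob p (Xdel ends e s W b))
    (F₂ := fun W => if v ∈ W then (1 : R) else 0)
    (fun W W' h => by simp only; linarith [hx_anti h]) hF₂
    (fun W => sub_nonneg.2 (prob_le_one hp _))
    (fun W => by by_cases hv : v ∈ W <;> simp [hv]) {s} {s}
  rw [Finset.inter_self, Finset.union_self,
    expect_update_one_K p ends e s T (fun W => 1 - prob p (Xdel ends e s W b)),
    expect_update_one_K p ends e s T (fun W => if v ∈ W then (1 : R) else 0),
    expect_update_one_K p ends e s T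
      ((fun W => 1 - prob p (Xdel ends e s W b)) * fun W => if v ∈ W then (1 : R) else 0),
    CCT.prob_update_one_eq, ← Rplus_eq] at key
  simp only [Pi.mul_apply] at key
  -- expand the sums
  set S := ∑ W : Set V, if s ∉ W then prob p (KEvent ends e T W) else 0 with hS
  set Sy := ∑ W : Set V, if s ∉ W then prob p (Xdel ends e s W b) * prob p (KEvent ends e T W)
    else 0 with hSy
  set Sv := ∑ W : Set V, if s ∉ W then (if v ∈ W then (1 : R) else 0) * prob p (KEvent ends e T W)
    else 0 with hSv
  set Syv := ∑ W : Set V, if s ∉ W then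
    (if v ∈ W then prob p (Xdel ends e s W b) else 0) * prob p (KEvent ends e T W) else 0 with hSyv
  have e1 : (∑ W : Set V, if s ∉ W then (1 - prob p (Xdel ends e s W b)) *
      prob p (KEvent ends e T W) else 0) = S - Sy := by
    rw [hS, hSy, ← Finset.sum_sub_distrib]
    refine Finset.sum_congr rfl fun W _ => ?_
    split_ifs <;> ring
  have e3 : (∑ W : Set V, if s ∉ W then (1 - prob p (Xdel ends e s W b)) *
      (if v ∈ W then (1 : R) else 0) * prob p (KEvent ends e T W) else 0) = Sv - Syv := by
    rw [hSv, hSyv, ← Finset.sum_sub_distrib]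
    refine Finset.sum_congr rfl fun W _ => ?_
    split_ifs <;> ring
  rw [e1, e3, hR] at key
  rw [hYV, hR, hY, hV]
  change Syv * S ≤ Sy * Sv
  nlinarith [key]

end Main

/-! ## The exact shift-product form of (MM0⁻) -/

section Identity

variable (p : E → R) (b v : V)

/-- `P(R⁻)² · E[(y − ȳ)(1_{V⁺} − c); gate]` with `ȳ = P(Y⁻ | R⁻)`, `c = P(V⁻ | R⁻)`, cleared:
the (MM0⁻) form in the `e`-vocabulary. -/
noncomputable def mm0minusForm : R :=
  prob p (Rminus ends e s T) ^ 2 * prob p (Xminus ends e s b ∩ Vplus ends e T v ∩ Rplus ends e s T)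
    - prob p (Rminus ends e s T) * prob p (Xminus ends e s b ∩ Rminus ends e s T) *
      prob p (Vplus ends e T v ∩ Rplus ends e s T)
    - prob p (Rminus ends e s T) * prob p (Vminus ends e T v ∩ Rminus ends e s T) *
      prob p (Xminus ends e s b ∩ Rplus ends e s T)
    + prob p (Xminus ends e s b ∩ Rminus ends e s T) * prob p (Vminus ends e T v ∩ Rminus ends e s T) *
      prob p (Rplus ends e s T)

/-- The cleared shift product `(a·Y_E − g·Y_R)·(a·Z_E − g·Z_R)`
`= a²g² · (E[y | gate] − E[y | R_T]) · (P(V⁺ | gate) − P(V⁻ | R_T))`. -/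
noncomputable def shiftProduct : R :=
  (prob p (Rminus ends e s T) * prob p (Xminus ends e s b ∩ Rplus ends e s T)
      - prob p (Rplus ends e s T) * prob p (Xminus ends e s b ∩ Rminus ends e s T)) *
    (prob p (Rminus ends e s T) * prob p (Vplus ends e T v ∩ Rplus ends e s T)
      - prob p (Rplus ends e s T) * prob p (Vminus ends e T v ∩ Rminus ends e s T))

/-- The BHK slack on the gate, cleared: `Y_E·Z_E − g·YZ_E ≥ 0` (`gate_cross_bhk`). -/
noncomputable def bhkSlack : R :=
  prob p (Xminus ends e s b ∩ Rplus ends e s T) * prob p (Vplus ends e T v ∩ Rplus ends e s T)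
    - prob p (Rplus ends e s T) * prob p (Xminus ends e s b ∩ Vplus ends e T v ∩ Rplus ends e s T)

omit [Fintype V] [DecidableEq V] [LinearOrder R] [IsStrictOrderedRing R] in
/-- **The exact identity** `g · F = −a² · slack + shiftProduct`. -/
theorem mm0minus_identity :
    prob p (Rplus ends e s T) * mm0minusForm ends e s T p b v =
      - prob p (Rminus ends e s T) ^ 2 * bhkSlack ends e s T p b v +
        shiftProduct ends e s T p b v := by
  unfold mm0minusForm bhkSlack shiftProduct
  ring

/-- The BHK slack is nonnegative. -/
theorem bhkSlack_nonneg (hp : IsProbVec p) : 0 ≤ bhkSlack ends e s T p b v := by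
  unfold bhkSlack
  linarith [gate_cross_bhk ends e s T p hp b v]

omit [Fintype V] [DecidableEq V] in
/-- **(MM0⁻) from «shift product ≤ a² · BHK slack»** (the gate has positive mass). -/
theorem mm0minus_of_shift_le_slack (hg : 0 < prob p (Rplus ends e s T))
    (h : shiftProduct ends e s T p b v ≤
      prob p (Rminus ends e s T) ^ 2 * bhkSlack ends e s T p b v) :
    mm0minusForm ends e s T p b v ≤ 0 := by
  have hid := mm0minus_identity ends e s T p b v
  have hgF : prob p (Rplus ends e s T) * mm0minusForm ends e s T p b v ≤
      prob p (Rplus ends e s T) * 0 := by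
    rw [mul_zero, hid]; linarith
  exact le_of_mul_le_mul_left hgF hg

/-- **(MM0⁻) in the agreeing-shift regime**: if the two shifts `E[y | gate] − ȳ` and
`P(V⁺ | gate) − c` have opposite signs (or one vanishes), (MM0⁻) holds. -/
theorem mm0minus_of_agreeing_shifts (hp : IsProbVec p) (hg : 0 < prob p (Rplus ends e s T))
    (h : shiftProduct ends e s T p b v ≤ 0) : mm0minusForm ends e s T p b v ≤ 0 :=
  mm0minus_of_shift_le_slack ends e s T p b v hg
    (le_trans h (mul_nonneg (sq_nonneg _) (bhkSlack_nonneg ends e s T p b v hp)))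

end Identity

end MM0GateBHK
end Summit.Ventures.PercRepro2
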